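/-
Copyright (c) 2026. All rights reserved.
Released under Apache 2.0 license as described in the file LICENSE.
Authors: abc-iut cell, campaign-S prover seat abc-iut-S1 (wave 1).
-/
import Mathlib.GroupTheory.Torsion
import Mathlib.RingTheory.IntegralDomain
import Mathlib.Data.Nat.Factors
import Literature.IUT.LogVolume.Teichmuller
import Literature.IUT.LogVolume.UnitLogFibres
import Literature.IUT.LogVolume.LogShellTopology
import HarnessLib

/-!
# The torsion `R^μ` of the units of a mixed-characteristic local field: `#R^μ = p^m·(p^f − 1)`

[IUTchIV] Prop. 1.4, kurims p. 13: "for `i ∈ I`, write `R^μ_i ⊆ R^×_i` for the torsion subgroup of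
`R^×_i`, `R^{×μ}_i := R^×_i/R^μ_i`, `p^{f_i}` for the cardinality of the residue field of `k_i`, and `p^{m_i}`
for the order of the `p`-primary component of `R^μ_i`. Thus, the order of `R^μ_i` is equal to
`p^{m_i}·(p^{f_i} − 1)`."  For `K` in the cell's norm-side MLF setting (proper) this file PROVES that
statement:

* `torsionUnits K = R^μ` (Mathlib `CommGroup.torsion Kˣ`; every root of unity of `K` is a unit of `R`);
* `exists_uniform_exponent` / `finite_torsionUnits` — there is `N` with `ζ^{(q−1)pᴺ} = 1` for EVERY
  `ζ ∈ R^μ` (Fermat + the uniform contraction `‖1 − y^{pᴺ}‖ ≤ c₀ᴺ` + `R^μ ∩ (1 + p²R) = 1`), so `R^μ`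
  is finite (hence cyclic);
* `torsionPExp p K = m` — **defined** as `v_p(#R^μ)`; `card_torsionUnits` — **`#R^μ = p^m·(p^f − 1)`**:
  `μ_{q−1}(K) ≤ R^μ` has order `q − 1` (`Teichmuller.lean`), and no prime `ℓ ≠ p` divides
  `#R^μ/(q−1)` (an element of order `ℓ(q−1)`, which is prime to `p`, would be killed by `q − 1`).
  Since `R^μ` is cyclic, `p^m` is then also the order of its `p`-primary component, as printed.

Classical (Neukirch ANT II (5.3), (5.7)); nothing disputed.
-/

noncomputable section

open Filter Metric Set IsLocalRing
open _root_.Topology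
open IsUltrametricDist
open scoped NormedField

namespace Literature.IUT.LogVolume

open Literature.NumberTheory.Transcendental Literature.NumberTheory.GaloisRepresentations.Ultrametric

variable (p : ℕ) [Fact p.Prime]
variable (K : Type*) [NontriviallyNormedField K] [instK : NormedAlgebra ℚ_[p] K] [IsUltrametricDist K]
  [ProperSpace K]

/-! ## `R^μ` -/

omit [IsUltrametricDist K] [ProperSpace K] in
/-- **`R^μ`, the torsion subgroup of `R^× ⊆ K^×`** ([IUTchIV] Prop. 1.4, p. 13): the roots of unity of `K`
(all of norm `1`, hence units of `R`), as a subgroup of `Kˣ` (Mathlib `CommGroup.torsion`).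
[claim: Mochizuki2012, status: disputed] -/
def torsionUnits : Subgroup Kˣ := CommGroup.torsion Kˣ

omit instK [IsUltrametricDist K] [ProperSpace K] in
/-- Membership in `R^μ`: `ζ ∈ R^μ ↔ ζⁿ = 1` for some `n ≥ 1` (`IsTorsionUnit`, `UnitLogFibres.lean`).
[claim: Mochizuki2012, status: disputed] -/
theorem mem_torsionUnits_iff (ζ : Kˣ) : ζ ∈ torsionUnits K ↔ IsTorsionUnit K (ζ : K) := by
  rw [torsionUnits, CommGroup.mem_torsion, isOfFinOrder_iff_pow_eq_one]
  constructor
  · rintro ⟨n, hn, h⟩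
    exact ⟨n, hn, by rw [← Units.val_pow_eq_pow_val, h, Units.val_one]⟩
  · rintro ⟨n, hn, h⟩
    exact ⟨n, hn, Units.ext (by rw [Units.val_pow_eq_pow_val, h, Units.val_one])⟩

omit instK [IsUltrametricDist K] [ProperSpace K] in
/-- Elements of `R^μ` have norm `1`. [claim: Mochizuki2012, status: disputed] -/
theorem norm_eq_one_of_mem_torsionUnits {ζ : Kˣ} (h : ζ ∈ torsionUnits K) : ‖(ζ : K)‖ = 1 :=
  ((mem_torsionUnits_iff K ζ).mp h).norm_eq_one

/-! ## A uniform exponent: `R^μ` is finite -/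

include instK in
/-- **Uniform contraction**: there is `N` such that `‖1 − y^{pᴺ}‖ ≤ p⁻²` for EVERY principal unit `y`
(`‖1 − y‖ ≤ p^{−1/e}` by discreteness, so the contraction factor is at most
`c₀ = max(p⁻¹, p^{−(p−1)/e}) < 1`). [cite: NeukirchANT1999, Ch. II (5.3)] -/
theorem exists_uniform_pow_prime_pow :
    ∃ N : ℕ, ∀ y : K, ‖1 - y‖ < 1 → ‖1 - y ^ (p ^ N)‖ ≤ (p : ℝ) ^ (-(2 : ℝ)) := by
  have hp : p.Prime := Fact.out
  have hp1 : (1 : ℝ) < p := by exact_mod_cast hp.one_lt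
  have hp0 : (0 : ℝ) < p := by linarith
  set s₀ : ℝ := (p : ℝ) ^ (-(1 / (absRamificationIdx p K : ℝ))) with hs₀
  have hs₀0 : 0 ≤ s₀ := (Real.rpow_pos_of_pos hp0 _).le
  have hs₀1 : s₀ < 1 := Real.rpow_lt_one_of_one_lt_of_neg hp1 (by
    have := absRamificationIdx_pos p K
    have : (0 : ℝ) < absRamificationIdx p K := by exact_mod_cast this
    have : 0 < 1 / (absRamificationIdx p K : ℝ) := div_pos one_pos this
    linarith)
  set c₀ : ℝ := max ‖(p : K)‖ (s₀ ^ (p - 1)) with hc₀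
  have hc₀0 : 0 ≤ c₀ := le_max_of_le_left (norm_nonneg _)
  have hc₀1 : c₀ < 1 := max_lt (IwasawaLog.norm_prime_lt_one (p := p) (F := K))
    (pow_lt_one₀ hs₀0 hs₀1 (by have := hp.two_le; omega))
  have hρ : (0 : ℝ) < (p : ℝ) ^ (-(2 : ℝ)) := Real.rpow_pos_of_pos hp0 _
  obtain ⟨N, hN⟩ := exists_pow_lt_of_lt_one hρ hc₀1
  refine ⟨N, fun y hy ↦ ?_⟩
  have hys : ‖1 - y‖ ≤ s₀ := norm_le_rpow_of_norm_lt_one p K hy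
  have hcy : max ‖(p : K)‖ (‖1 - y‖ ^ (p - 1)) ≤ c₀ :=
    max_le_max le_rfl (pow_le_pow_left₀ (norm_nonneg _) hys _)
  calc ‖1 - y ^ (p ^ N)‖ ≤ (max ‖(p : K)‖ (‖1 - y‖ ^ (p - 1))) ^ N * ‖1 - y‖ :=
        norm_one_sub_pow_prime_pow_le p K hy.le N
    _ ≤ c₀ ^ N * 1 :=
        mul_le_mul (pow_le_pow_left₀ (le_max_of_le_left (norm_nonneg _)) hcy N) hy.le
          (norm_nonneg _) (pow_nonneg hc₀0 N)
    _ ≤ (p : ℝ) ^ (-(2 : ℝ)) := by rw [mul_one]; exact hN.le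

include instK in
/-- **A uniform exponent for `R^μ`**: there is `N` with `ζ^{(q−1)·pᴺ} = 1` for every `ζ ∈ R^μ`
(`ζ^{q−1} ∈ 1 + 𝔪` by Fermat, then `(ζ^{q−1})^{pᴺ} ∈ R^μ ∩ (1 + p²R) = {1}`).
[claim: Mochizuki2012, status: disputed] -/
theorem exists_uniform_exponent :
    ∃ N : ℕ, ∀ ζ : Kˣ, ζ ∈ torsionUnits K → ζ ^ ((p ^ residueDegree p K - 1) * p ^ N) = 1 := by
  obtain ⟨N, hN⟩ := exists_uniform_pow_prime_pow p K
  refine ⟨N, fun ζ hζ ↦ ?_⟩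
  have hζ1 : ‖(ζ : K)‖ = 1 := norm_eq_one_of_mem_torsionUnits K hζ
  have hT : IsTorsionUnit K (ζ : K) := (mem_torsionUnits_iff K ζ).mp hζ
  have hyP : IsPrincipal ((ζ : K) ^ (p ^ residueDegree p K - 1)) :=
    isPrincipal_pow_residueCard_sub_one p K hζ1
  have hsmall := hN _ hyP
  rw [← pow_mul] at hsmall
  -- the element `ζ^((q-1) p^N)` is torsion and lies in the injectivity ball, hence is `1`
  have hT' : IsTorsionUnit K ((ζ : K) ^ ((p ^ residueDegree p K - 1) * p ^ N)) := by
    obtain ⟨n, hn, h1⟩ := hT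
    exact ⟨n, hn, by rw [← pow_mul, mul_comm, pow_mul, h1, one_pow]⟩
  have h1 := hT'.eq_one_of_norm_one_sub_le p K (rpow_neg_two_mul_lt_one p) hsmall
  exact Units.ext (by rw [Units.val_pow_eq_pow_val, Units.val_one]; exact h1)

include instK in
/-- `R^μ ≤ μ_M(K)` for the uniform exponent `M = (q−1)pᴺ`. [claim: Mochizuki2012, status: disputed] -/
theorem torsionUnits_le_rootsOfUnity :
    ∃ M : ℕ, 0 < M ∧ torsionUnits K ≤ rootsOfUnity M K := by
  obtain ⟨N, hN⟩ := exists_uniform_exponent p K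
  refine ⟨(p ^ residueDegree p K - 1) * p ^ N,
    Nat.mul_pos (Nat.pos_of_ne_zero (residueCard_sub_one_ne_zero p K))
      (pow_pos (Fact.out : p.Prime).pos N), fun ζ hζ ↦ ?_⟩
  rw [mem_rootsOfUnity]
  exact hN ζ hζ

include instK in
/-- **`R^μ` is finite.** [claim: Mochizuki2012, status: disputed] -/
theorem finite_torsionUnits : Finite (torsionUnits K) := by
  obtain ⟨M, hM, hle⟩ := torsionUnits_le_rootsOfUnity p K
  haveI : NeZero M := ⟨hM.ne'⟩
  exact Finite.of_injective (Subgroup.inclusion hle) (Subgroup.inclusion_injective hle)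

omit [IsUltrametricDist K] [ProperSpace K] in
/-- `μ_k(K) ≤ R^μ`. [claim: Mochizuki2012, status: disputed] -/
theorem rootsOfUnity_le_torsionUnits (k : ℕ) [NeZero k] : rootsOfUnity k K ≤ torsionUnits K := by
  intro ζ hζ
  rw [mem_rootsOfUnity] at hζ
  change IsOfFinOrder ζ
  exact isOfFinOrder_iff_pow_eq_one.mpr ⟨k, Nat.pos_of_ne_zero (NeZero.ne k), hζ⟩

/-! ## `#R^μ = p^m · (p^f − 1)` -/

/-- **`m`: the exponent of `p` in `#R^μ`** ("`p^{m_i}` the order of the `p`-primary component of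
`R^μ_i`", [IUTchIV] Prop. 1.4 p. 13; `R^μ` being cyclic, this is the same number). Defined as
`v_p(#R^μ)`. [claim: Mochizuki2012, status: disputed] -/
def torsionPExp : ℕ := padicValNat p (Nat.card (torsionUnits K))

include instK in
/-- An element of `R^μ` of order prime to `p` is killed by `q − 1` (its `(q−1)`-th power is a principal
unit of order prime to `p`, hence `1`). [claim: Mochizuki2012, status: disputed] -/
theorem pow_residueCard_sub_one_eq_one_of_not_dvd_orderOf {ζ : Kˣ} (hζ : ζ ∈ torsionUnits K)
    (hp : ¬ p ∣ orderOf ζ) : ζ ^ (p ^ residueDegree p K - 1) = 1 := by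
  have hζ1 : ‖(ζ : K)‖ = 1 := norm_eq_one_of_mem_torsionUnits K hζ
  have hP : IsPrincipal ((ζ : K) ^ (p ^ residueDegree p K - 1)) :=
    isPrincipal_pow_residueCard_sub_one p K hζ1
  -- `(ζ^(q-1))^(orderOf ζ) = 1` with `p ∤ orderOf ζ`
  have hpow : ((ζ : K) ^ (p ^ residueDegree p K - 1)) ^ orderOf ζ = 1 := by
    rw [← pow_mul, mul_comm, pow_mul, ← Units.val_pow_eq_pow_val, pow_orderOf_eq_one, Units.val_one,
      one_pow]
  have h1 := eq_one_of_pow_eq_one_of_not_dvd p K hp hpow hP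
  exact Units.ext (by rw [Units.val_pow_eq_pow_val, Units.val_one]; exact h1)

include instK in
/-- **`#R^μ = p^m·(p^f − 1)`** ([IUTchIV] Prop. 1.4, p. 13: "the order of `R^μ_i` is equal to
`p^{m_i}·(p^{f_i} − 1)`"). [claim: Mochizuki2012, status: disputed] -/
theorem card_torsionUnits :
    Nat.card (torsionUnits K) = p ^ torsionPExp p K * (p ^ residueDegree p K - 1) := by
  classical
  haveI := finite_torsionUnits p K
  have hp : p.Prime := Fact.out
  set q1 := p ^ residueDegree p K - 1 with hq1
  have hq10 : q1 ≠ 0 := residueCard_sub_one_ne_zero p K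
  haveI : NeZero q1 := ⟨hq10⟩
  set N := Nat.card (torsionUnits K) with hNdef
  have hN0 : N ≠ 0 := Nat.card_pos.ne'
  -- `q - 1 ∣ N`: `μ_{q-1}(K)` is a subgroup of `R^μ` of order `q - 1`
  have hdvd : q1 ∣ N := by
    have h := Subgroup.card_dvd_of_le (rootsOfUnity_le_torsionUnits K q1)
    rwa [card_rootsOfUnity_residueCard_sub_one p K] at h
  obtain ⟨N', hN'⟩ := hdvd
  have hN'0 : N' ≠ 0 := fun h ↦ hN0 (by rw [hN', h, mul_zero])
  -- every prime factor of `N'` is `p`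
  have hprime : ∀ {ℓ : ℕ}, ℓ.Prime → ℓ ∣ N' → ℓ = p := by
    intro ℓ hℓ hℓN'
    by_contra hℓp
    -- an element of order `ℓ · (q-1)` exists in the cyclic group `R^μ`
    obtain ⟨g, hg⟩ := IsCyclic.exists_ofOrder_eq_natCard (α := torsionUnits K)
    have hdℓ : q1 * ℓ ∣ orderOf g := by
      rw [hg, ← hNdef, hN']; exact Nat.mul_dvd_mul_left q1 hℓN'
    set x := g ^ (orderOf g / (q1 * ℓ)) with hx
    have hk0 : orderOf g / (q1 * ℓ) ≠ 0 := by
      intro h0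
      have := Nat.div_eq_zero_iff.mp h0
      rcases this with h | h
      · exact (Nat.mul_ne_zero hq10 hℓ.ne_zero) h
      · rw [hg] at h
        exact absurd (Nat.le_of_dvd Nat.card_pos (hg ▸ hdℓ)) (not_le.mpr h)
    have hox : orderOf x = q1 * ℓ := by
      rw [hx, orderOf_pow_of_dvd hk0 (Nat.div_dvd_of_dvd hdℓ), Nat.div_div_self hdℓ (hg ▸ hN0)]
    -- its order is prime to `p`, so it is killed by `q - 1`: contradiction
    have hxp : ¬ p ∣ orderOf (x : Kˣ) := by
      rw [Subgroup.orderOf_coe, hox]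
      intro h
      rcases (Nat.Prime.dvd_mul hp).mp h with h | h
      · exact not_dvd_residueCard_sub_one p K h
      · exact hℓp ((Nat.prime_dvd_prime_iff_eq hp hℓ).mp h).symm
    have hkill := pow_residueCard_sub_one_eq_one_of_not_dvd_orderOf p K x.2 hxp
    have hord : orderOf (x : Kˣ) ∣ q1 := orderOf_dvd_of_pow_eq_one hkill
    rw [Subgroup.orderOf_coe, hox] at hord
    have : q1 * ℓ ≤ q1 := Nat.le_of_dvd (Nat.pos_of_ne_zero hq10) hord
    have : 2 ≤ ℓ := hℓ.two_le
    nlinarith [Nat.pos_of_ne_zero hq10]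
  obtain ⟨k, hk⟩ : ∃ k : ℕ, N' = p ^ k := ⟨_, Nat.eq_prime_pow_of_unique_prime_dvd hN'0 hprime⟩
  -- read off `m = v_p(N) = k`
  have hm : torsionPExp p K = k := by
    rw [torsionPExp, ← hNdef, hN', hk, padicValNat.mul hq10 (pow_ne_zero _ hp.ne_zero),
      padicValNat.prime_pow, padicValNat.eq_zero_of_not_dvd (not_dvd_residueCard_sub_one p K), zero_add]
  rw [hm, hN', hk, mul_comm]

end Literature.IUT.LogVolume

end
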